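import Summits.QuantumFields.YangMills.Theorems.UnitScaleTiltProp8FlatPortChart
import Literature.MathematicalPhysics.QuantumFieldTheory.Balaban1983to89.B6GlobalChartV1L0
import HarnessLib

/-!
# Route `UnitScaleTilt`, crux K1 «MinimiserStabilityRegPr» (stmt-QuantumFields-19200), leaf V2′ `stub_halvingStep` — pillar P2 `stub_flatOpsCubeSeq`, THE PORT BRIDGE,
# LEVEL-0 TWIN OF FILE 1 (`FlatPortChart` §4): **EVERY (2.2)-ADMISSIBLE V1 FAMILY — `Λ₀ = T ∖ Ω₁` ADMITTED — IS lit-balaban's LEVEL-0 TORUS FAMILY, AND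
# `B6GlobalChartV1L0.domT` OF IT IS THE FAMILY**

Cell `ym3-torus`, seat `ym3-torus-p1` g18 (GAP LIST v22 item (P2-L0), UV3-NODE §26.3: «file 1's `tdOfAdm` drops `h1 : D.Om 1 = univ` the day `B6GlobalChartV1L0` lands»;
it landed 2026-08-27).  The g17 chart `FlatPortChart.tdOfAdm` needed `Ω₁ = T` because the V1 torus structure `B6MultiLevelTorusOperator.TDomains` floors the level
function at `1`; lit-balaban's level-0 twin `B6MultiLevelTorusOperatorL0.TDomains` (r03, G-F3′-L0 §4: levels `0, …, k`, (2.1) for every `j ≥ 1`, (2.2) verbatim)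
has no floor, and `B6GlobalChartV1L0.domT` keeps the SAME formula on the levels `≥ 1`.  So: **`tdOfAdmL0`** — an `Adm22 D R (L·M_h)` family of the V1 global torus
with `D.k = k ≥ 1` levels IS a level-0 torus family (level function `j(·) ∘ ofBox` of file 1; (2.1) = `Adm22`'s block clause through `blk_bigSide_ofBox`; (2.2) =
`Adm22`'s separation clause through the reverse cross-level inequality `pow_mul_distSite_iterBlockOf_le`), with NO hypothesis on `Ω₁`; and **`domT_tdOfAdmL0`**:
`B6GlobalChartV1L0.domT hN (tdOfAdmL0 …) hk = D`.  Hence every row of the level-0 k-level lineage stated for `domT hN D′ hk` will hold for the cube sequences (144)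
(`FlatCubeSequence.cubeSeq`, `Λ₀ = T ∖ □₁ ≠ ∅`) by `rw`, exactly as files 2–11 of the g17 bridge do for `Ω₁ = T` — their level-0 twins wait only for the remaining
S-E twins (`B6Cor28EntriesKLevelV1L0`, `B6QGQCoerciveKLevelV1L0`, `B6Prop26LapKLevelV1L0`, `B6PadLevelV1L0`, `B6Ineq2142KLevelV1L0`).  One definition (`tdOfAdmL0`)
and one theorem; §1–§3 of file 1 are consumed BY NAME.  NOT a claim about the mass gap.

References: T. Bałaban, CMP **96** (1984) 223–250 [Balaban1984PropagatorsII] ((2.1)–(2.4) p.224); CMP **102** (1985) 277–309 [Balaban1985Variational] ((144) p.300,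
(161) p.303).
-/

noncomputable section

open scoped BigOperators

namespace Summit.QuantumFields.YangMills.Theorems.FlatPortChartL0

open Literature.MathematicalPhysics.QuantumFieldTheory.Balaban1983to89
open B4Reflection242 (boxDom mem_boxDom blk)
open B4TorusKernel.MultiPeriod (torusSupNorm)
open B5Eq117TorusCarriers (Mk)
open B5Eq118OneStroke (iterBlockOf val_iterBlockOf iterBlockOf_succ iterBlockOf_zero)
open B5Prop12FieldsLattice (distSite distSite_self distSite_nonneg)
open B5RowSumsP12Lattice (distSite_comm)
open B6MultiLevelBoxOperator (N0 bigSide bigSide_eq)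
open B6MultiLevelTorusOperatorL0 (TDomains)
open B6GlobalChartV1 (PV toBox toBox_apply toBox_injective blk_toBox)
open B6GlobalChartV1L0 (domT)
open B6SectADomainsV1 (Domains)
open B11Eq115Space (levOf levOf_le mem_levOf le_levOf)
open FlatCubeOpsText (Adm22)
open FlatPortChart (ofBox toBox_ofBox ofBox_toBox levV levV_le le_levV_iff not_inOm_of_levV_lt pow_mul_distSite_iterBlockOf_le natCast_add_one_le_distSite
  distSite_zero_eq_torusSupNorm domains_ext blk_bigSide_ofBox)

variable {d ℓ m K : ℕ} {hd : 1 ≤ d + 1} {hL : Odd (ℓ + 1) ∧ 1 < ℓ + 1}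

section TD

variable {Mh k R : ℕ} {P' : Fin (d + 1) → ℕ}

/-- **THE LEVEL-0 TORUS FAMILY OF AN ADMISSIBLE V1 FAMILY** (`k ≥ 1` levels, big blocks `M = L·M_h`, separation `R`; `Λ₀ = T ∖ Ω₁` admitted): level function
`j(·) ∘ ofBox`; (2.1) = `Adm22`'s block clause (every `j ≥ 1`), (2.2) = `Adm22`'s separation clause read through `FlatPortChart` §3. [cite: Balaban1984PropagatorsII, (2.1)-(2.4) p.224] -/
def tdOfAdmL0 (hN : ∀ μ, N0 ℓ Mh k P' μ = (PV d ℓ m K hd hL).sitesPerDir 0) (D : Domains (PV d ℓ m K hd hL)) (hDk : D.k = k)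
    (hk : k ≤ m + K) (hAdm : Adm22 D R ((ℓ + 1) * Mh)) : TDomains d ℓ Mh k P' R where
  lev z := levV D (ofBox (m := m) (K := K) (hd := hd) (hL := hL) z)
  lev_le z := (levV_le D _).trans hDk.le
  bigBlocks j hj1 z hz z' hz' hblk := by
    by_cases hjk : j ≤ k
    · have hjD : j ≤ D.k := hDk ▸ hjk
      rw [le_levV_iff D hjD, le_levV_iff D hjD]
      show iterBlockOf j (ofBox z) ∈ D.Om j ↔ iterBlockOf j (ofBox z') ∈ D.Om j
      refine hAdm.1 j hj1 _ _ fun μ => ?_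
      have e1 := blk_bigSide_ofBox (m := m) (K := K) (hd := hd) (hL := hL) hN (hjk.trans hk) hz μ
      have e2 := blk_bigSide_ofBox (m := m) (K := K) (hd := hd) (hL := hL) hN (hjk.trans hk) hz' μ
      have h := congrFun hblk μ
      rw [e1, e2] at h
      exact_mod_cast h.symm
    · constructor
      · intro h; exact absurd (h.trans ((levV_le D _).trans hDk.le)) hjk
      · intro h; exact absurd (h.trans ((levV_le D _).trans hDk.le)) hjk
  sepT j z hz z' hz' hlt hle := by
    -- `j + 1 ≤ k`
    have hjk : j + 1 ≤ k := hle.trans ((levV_le D _).trans hDk.le)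
    have hjmK : j + 1 ≤ m + K := hjk.trans hk
    set s : Site (PV d ℓ m K hd hL) 0 := ofBox z with hs
    set s' : Site (PV d ℓ m K hd hL) 0 := ofBox z' with hs'
    -- the two hypotheses of (2.2)
    have hin : blockOf (iterBlockOf j s') ∈ D.Om (j + 1) := by
      rw [← iterBlockOf_succ]
      exact (le_levV_iff D (hDk ▸ hjk) s').1 hle
    have hout : iterBlockOf j s ∉ D.Om j := not_inOm_of_levV_lt D hlt
    have hsep := hAdm.2 j (iterBlockOf j s') (iterBlockOf j s) hin hout
    -- `R·M + 1 ≤ dist_j`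
    have hsep1 := natCast_add_one_le_distSite hsep
    -- `L^j·dist_j ≤ dist₀ + L^j − 1`
    have hjPV : j ≤ (PV d ℓ m K hd hL).m + (PV d ℓ m K hd hL).K := by change j ≤ m + K; omega
    have hup := pow_mul_distSite_iterBlockOf_le (P := PV d ℓ m K hd hL) j hjPV s' s
    have hL1 : (1 : ℝ) ≤ ((ℓ + 1 : ℕ) : ℝ) := by exact_mod_cast Nat.succ_pos ℓ
    have hLj : (1 : ℝ) ≤ ((ℓ + 1 : ℕ) : ℝ) ^ j := one_le_pow₀ hL1
    have hd0 : distSite (Mk (PV d ℓ m K hd hL) 0) s' s = torusSupNorm (N0 ℓ Mh k P') (z - z') := by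
      rw [distSite_comm, distSite_zero_eq_torusSupNorm hN, hs, hs', toBox_ofBox hN ⟨z, hz⟩, toBox_ofBox hN ⟨z', hz'⟩]
    rw [← hd0]
    have hbig : ((R * bigSide ℓ Mh j : ℕ) : ℝ) = ((ℓ + 1 : ℕ) : ℝ) ^ j * ((R * ((ℓ + 1) * Mh) : ℕ) : ℝ) := by
      rw [bigSide_eq]; push_cast; ring
    rw [hbig]
    have hLP : ((PV d ℓ m K hd hL).L : ℝ) = ((ℓ + 1 : ℕ) : ℝ) := rfl
    rw [hLP] at hup
    have h2 : ((ℓ + 1 : ℕ) : ℝ) ^ j * (((R * ((ℓ + 1) * Mh) : ℕ) : ℝ) + 1) ≤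
        ((ℓ + 1 : ℕ) : ℝ) ^ j * distSite (Mk (PV d ℓ m K hd hL) j) (iterBlockOf j s') (iterBlockOf j s) :=
      mul_le_mul_of_nonneg_left hsep1 (by positivity)
    rw [mul_add, mul_one] at h2
    linarith [h2, hup, hLj]

/-- **`domT` (LEVEL-0 TWIN) OF THE TORUS FAMILY IS THE V1 FAMILY** (no hypothesis on `Ω₁`): so every row of the level-0 k-level lineage stated for
`B6GlobalChartV1L0.domT hN D′ hk` holds for the admissible `D` by `rw` — in particular for the cube sequences (144) with `Λ₀ = T ∖ □₁`. [cite: Balaban1984PropagatorsII, (2.1)-(2.4) p.224] -/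
theorem domT_tdOfAdmL0 (hN : ∀ μ, N0 ℓ Mh k P' μ = (PV d ℓ m K hd hL).sitesPerDir 0) (D : Domains (PV d ℓ m K hd hL)) (hDk : D.k = k)
    (hk : k ≤ m + K) (hAdm : Adm22 D R ((ℓ + 1) * Mh)) :
    domT hN (tdOfAdmL0 hN D hDk hk hAdm) hk = D := by
  classical
  refine domains_ext (by rw [hDk]; rfl) (funext fun j => ?_)
  ext y
  by_cases hj0 : j = 0
  · subst hj0
    rw [D.Om_zero]
    simp [domT]
  by_cases hjk : j ≤ k
  · have hjD : j ≤ D.k := hDk ▸ hjk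
    simp only [domT, hj0, if_false, hjk, if_true, Finset.mem_filter, Finset.mem_univ, true_and]
    constructor
    · intro h
      obtain ⟨x, hx⟩ := B6ScalarChartV1.exists_iterBlockOf_eq (d := d) (ℓ := ℓ) (hd := hd) (hL := hL) (hjk.trans hk) y
      have := h x hx
      change j ≤ levV D (ofBox (toBox hN x : Fin (d + 1) → ℤ)) at this
      rw [ofBox_toBox hN, le_levV_iff D hjD] at this
      rw [← hx]
      exact this
    · intro hy x hx
      change j ≤ levV D (ofBox (toBox hN x : Fin (d + 1) → ℤ))
      rw [ofBox_toBox hN, le_levV_iff D hjD]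
      show iterBlockOf j x ∈ D.Om j
      rw [hx]
      exact hy
  · have hjD : D.k < j := by rw [hDk]; omega
    rw [D.Om_eq_empty hjD]
    simp [domT, hj0, hjk]

end TD

end Summit.QuantumFields.YangMills.Theorems.FlatPortChartL0

end
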